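import Summits.Parity.GeneralizedHardyLittlewood.Theorems.DicksonFibrationDimOneDefs
import Summits.Parity.GeneralizedHardyLittlewood.Theorems.LeeYangFibresAbsoluteUpgradeSinglesDecayScale
import Mathlib.Analysis.SpecialFunctions.Pow.Asymptotics
import HarnessLib

/-!
# Route `DicksonFibration`, crux `DimOne` (stmt-Parity-0819), line `birth` (sieve-model reshape):
# helper file 1 for the stub `stub_sieveCount` — the sieve engine and the thresholds in `N`

Tools for the registered stub `stub_sieveCount : SieveCount` (file
`Theorems/DicksonFibrationDimOneStubSieveCount.lean`) and its sibling `stub_primeSieve`, about the sieve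
model `Λ♯_N` of the vocabulary file `Theorems/DicksonFibrationDimOneDefs.lean` (`u = u_N = ⌈√(log N)⌉`,
`y = y_N = N^{1/u}`, `P = P_N = P(⌊y⌋ + 1) = ∏_{p ≤ ⌊y⌋} p`):

* `abs_sifted_card_sub_le` — the TWO-SIDED Fundamental Lemma for the values of `F ∈ ℤ[X]` on an integer
  interval `I = [m₁, m₂]` (tree: `SieveSequence.fundamental_lemma_uniform_holds` applied to
  `AbsoluteUpgrade.valSeq F I #I`): `|#{m ∈ I : (F(m), P(z)) = 1} − #I V(z)| ≤ C_FL #I V(z) e^{−log D/log z} + D²`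
  (remainders `|R_d| ≤ ω_F(d) ≤ d ≤ D` for the `≤ D` squarefree moduli `d ≤ D`);
* `weight_pow_mul_prod_eq` — the main terms of `Λ♯` and of the sieve agree EXACTLY:
  `(P/φ(P))^t ∏_{p ≤ n} (1 − ω_{F_Ψ}(p)/p) = ∏_{p ≤ n} β_p(Ψ)` (`1 − ω(p)/p = β_p (1 − 1/p)^t`,
  `AbsoluteUpgrade.prod_one_sub_rootCount_eq`, and `φ(P)/P = ∏_{p ≤ n} (1 − 1/p)`);
* `weight_le` — Mertens: `P/φ(P) ≤ e⁵ log n` (tree: `MertensBound.exp_neg_div_log_le_prod_one_sub_inv`);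
* `eventually_roughLevel` (registered sub-goal) — eventually `N ≥ 1`, `u ≥ 17`, `y ≥ c`,
  `⌊y⌋ + 1 ≤ N^{1/8}`;
* `eventually_decay`, `eventually_pow_log_mul_rpow` — the two error numerics
  `A (log N)^t e^{−u/16} → 0` (`(log N)^t ≤ u^{2t}`, `x^{2t} e^{−x/16} → 0`) and
  `A (log N)^t N^{1/4} ≤ η N` (`(log N)^t = o(N^{3/4})`).

References: J. Friedlander, H. Iwaniec, *Opera de Cribro* (2010), Cor. 6.10
[FriedlanderIwaniecOpera2010]; H. Halberstam, H.-E. Richert, *Sieve Methods* (1974), Thm. 2.5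
[HalberstamRichert1974]; B. Green, T. Tao, Ann. of Math. 171 (2010), (1.5)–(1.7) [GreenTao2010].
-/

noncomputable section

open scoped BigOperators Classical
open Finset Filter Polynomial Literature.NumberTheory.Sieve
open Summit.Parity.GeneralizedHardyLittlewood.Theorems.AbsoluteUpgrade

namespace Summit.Parity.GeneralizedHardyLittlewood.Cruxes.DimOne.BirthSieve

variable {t : ℕ}

/-! ### The two-sided Fundamental Lemma for the values of a polynomial on an integer interval -/

/-- **Two-sided Fundamental Lemma for `{F(m) : m ∈ [m₁, m₂]}`.** If the root density of `F` has a
sieve dimension for which the uniform Fundamental Lemma holds with constant `C_FL`, `F > 0` on the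
integer interval `I = [m₁, m₂]` and `2 ≤ z ≤ D`, then
`|#{m ∈ I : (F(m), P(z)) = 1} − #I · V(z)| ≤ C_FL #I V(z) e^{−log D/log z} + D²`
(`V(z) = ∏_{p<z} (1 − ω_F(p)/p)`; remainders `|R_d| ≤ ω_F(d) ≤ d ≤ D` for the `≤ D` moduli `d ≤ D`).
[cite: FriedlanderIwaniecOpera2010, Cor. 6.10] -/
theorem abs_sifted_card_sub_le {κ K CFL : ℝ}
    (hFL : ∀ A : SieveSequence, HasSieveDimension A.density κ K →
      ∀ x z D : ℝ, 2 ≤ z → z ≤ D → 0 ≤ A.size x →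
        |A.sifted x (primesProdBelow z) - A.size x * A.densityProduct (primesProdBelow z)| ≤
          CFL * A.size x * A.densityProduct (primesProdBelow z) *
              Real.exp (-(Real.log D / Real.log z)) +
            ∑ d ∈ (primesProdBelow z).divisors.filter (fun d : ℕ => (d : ℝ) ≤ D),
              |A.remainder d x|)
    {F : ℤ[X]} (hdim : HasSieveDimension (rootDensity F) κ K) {m₁ m₂ : ℤ}
    {xF : ℝ} (hxF : ∀ m ∈ Icc m₁ m₂, 0 < F.eval m ∧ ((F.eval m : ℤ) : ℝ) ≤ xF)
    {z D : ℝ} (hz : 2 ≤ z) (hzD : z ≤ D) :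
    |(#((Icc m₁ m₂).filter (fun m : ℤ => (F.eval m).natAbs.Coprime (primesProdBelow z))) : ℝ) -
        #(Icc m₁ m₂) * ∏ p ∈ Nat.primesBelow ⌈z⌉₊, (1 - (polyRootCountMod ![F] p : ℝ) / p)| ≤
      CFL * #(Icc m₁ m₂) *
          (∏ p ∈ Nat.primesBelow ⌈z⌉₊, (1 - (polyRootCountMod ![F] p : ℝ) / p)) *
            Real.exp (-(Real.log D / Real.log z)) + D ^ 2 := by
  -- adapted from `AbsoluteUpgrade.sifted_card_le` (one-sided version with remainder `∑ ω_F(d)`)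
  set I := Icc m₁ m₂ with hIdef
  set P := primesProdBelow z with hP
  set A : SieveSequence := valSeq F I (#I : ℝ) with hA
  have hX0 : (0 : ℝ) ≤ #I := Nat.cast_nonneg _
  have hD0 : 0 ≤ D := by linarith
  have hsift : A.sifted xF P = #(I.filter (fun m : ℤ => (F.eval m).natAbs.Coprime P)) := by
    rw [hA, valSeq_sifted F I _ hxF P]
  have h := hFL A hdim xF z D hz hzD hX0
  rw [valSeq_densityProduct, valSeq_size, hsift] at h
  -- remainders: `|R_d| ≤ ω_F(d) ≤ d ≤ D`
  have hRd : ∀ d ∈ P.divisors.filter (fun d : ℕ => (d : ℝ) ≤ D), |A.remainder d xF| ≤ D := by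
    intro d hd
    have hd0 : 0 < d := Nat.pos_of_mem_divisors (Finset.mem_filter.mp hd).1
    refine (abs_valSeq_remainder_le F I _ hxF hd0).trans ?_
    calc ∑ s ∈ rootsMod F d, |((#(I.filter fun n : ℤ => n ≡ (s : ℤ) [ZMOD d]) : ℝ) - (#I : ℝ) / d)|
        ≤ ∑ _s ∈ rootsMod F d, (1 : ℝ) :=
          Finset.sum_le_sum fun s _ => abs_card_Icc_filter_modEq_sub_le hd0 m₁ m₂ (s : ℤ)
      _ = (polyRootCountMod ![F] d : ℝ) := by
          rw [Finset.sum_const, nsmul_eq_mul, mul_one, card_rootsMod]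
      _ ≤ d := by exact_mod_cast polyRootCountMod_le _ d
      _ ≤ D := (Finset.mem_filter.mp hd).2
  -- at most `⌊D⌋ ≤ D` moduli
  have hcardD : (#(P.divisors.filter (fun d : ℕ => (d : ℝ) ≤ D)) : ℝ) ≤ D := by
    have h1 : #(P.divisors.filter (fun d : ℕ => (d : ℝ) ≤ D)) ≤ #(Icc 1 ⌊D⌋₊) :=
      Finset.card_le_card ((divisors_filter_subset z D).trans (Finset.filter_subset _ _))
    rw [Nat.card_Icc, Nat.add_sub_cancel] at h1
    exact (Nat.cast_le.mpr h1).trans (Nat.floor_le hD0)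
  have hRsum : ∑ d ∈ P.divisors.filter (fun d : ℕ => (d : ℝ) ≤ D), |A.remainder d xF| ≤ D ^ 2 :=
    calc _ ≤ ∑ _d ∈ P.divisors.filter (fun d : ℕ => (d : ℝ) ≤ D), D := Finset.sum_le_sum hRd
      _ = #(P.divisors.filter (fun d : ℕ => (d : ℝ) ≤ D)) * D := by
          rw [Finset.sum_const, nsmul_eq_mul]
      _ ≤ D * D := mul_le_mul_of_nonneg_right hcardD hD0
      _ = D ^ 2 := (sq D).symm
  linarith

/-! ### The main term: `(P/φ(P))^t V(z) = ∏_{p ≤ ⌊y⌋} β_p` -/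

/-- `φ(P(z))/P(z) = ∏_{p<z} (1 − 1/p)`. [folklore] -/
theorem totient_primesProdBelow_div (z : ℝ) :
    ((Nat.totient (primesProdBelow z) : ℕ) : ℝ) / (primesProdBelow z : ℝ) =
      ∏ p ∈ Nat.primesBelow ⌈z⌉₊, (1 - (p : ℝ)⁻¹) := by
  -- adapted from `Literature.NumberTheory.Sieve.CFZ.totient_primorial_div`
  have hP : (0 : ℝ) < primesProdBelow z := by
    exact_mod_cast Nat.pos_of_ne_zero (primesProdBelow_ne_zero z)
  have h := Nat.totient_eq_mul_prod_factors (primesProdBelow z)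
  rw [primeFactors_primesProdBelow] at h
  have h' := congrArg (fun q : ℚ => (q : ℝ)) h
  push_cast at h'
  rw [div_eq_iff hP.ne', mul_comm]
  exact h'

/-- `0 < ∏_{p<z} (1 − 1/p)`. [folklore] -/
theorem prod_primesBelow_one_sub_inv_pos (w : ℕ) :
    0 < ∏ p ∈ Nat.primesBelow w, (1 - (p : ℝ)⁻¹) :=
  Finset.prod_pos fun p hp => by
    have hp2 : (2 : ℝ) ≤ p := by exact_mod_cast (Nat.prime_of_mem_primesBelow hp).two_le
    rw [sub_pos]
    exact inv_lt_one_of_one_lt₀ (by linarith)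

/-- **The main terms agree**: with `z = n + 1` and `P = P(z) = ∏_{p ≤ n} p`,
`(P/φ(P))^t · ∏_{p<z} (1 − ω_{F_Ψ}(p)/p) = ∏_{p ≤ n} β_p(Ψ)` (`1 − ω(p)/p = β_p (1 − 1/p)^t` and
`φ(P)/P = ∏_{p ≤ n} (1 − 1/p)`). [cite: GreenTao2010, (1.6)–(1.7)] -/
theorem weight_pow_mul_prod_eq (Ψ : Fin t → AffLinForm 1) (n : ℕ) :
    ((primesProdBelow ((n + 1 : ℕ) : ℝ) : ℝ) /
          (Nat.totient (primesProdBelow ((n + 1 : ℕ) : ℝ)) : ℝ)) ^ t *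
        ∏ p ∈ Nat.primesBelow ⌈((n + 1 : ℕ) : ℝ)⌉₊,
          (1 - (polyRootCountMod ![sysPoly Ψ] p : ℝ) / p) =
      singularProductPartial Ψ n := by
  rw [prod_one_sub_rootCount_eq, Nat.ceil_natCast, Nat.add_sub_cancel]
  have hPi : ((Nat.totient (primesProdBelow ((n + 1 : ℕ) : ℝ)) : ℕ) : ℝ) /
      (primesProdBelow ((n + 1 : ℕ) : ℝ) : ℝ) = ∏ p ∈ Nat.primesBelow (n + 1), (1 - (p : ℝ)⁻¹) := by
    have h := totient_primesProdBelow_div ((n + 1 : ℕ) : ℝ)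
    rwa [Nat.ceil_natCast] at h
  have hPi0 := prod_primesBelow_one_sub_inv_pos (n + 1)
  have hW : (primesProdBelow ((n + 1 : ℕ) : ℝ) : ℝ) /
      (Nat.totient (primesProdBelow ((n + 1 : ℕ) : ℝ)) : ℝ) =
        (∏ p ∈ Nat.primesBelow (n + 1), (1 - (p : ℝ)⁻¹))⁻¹ := by
    rw [← hPi, inv_div]
  rw [hW, inv_pow, mul_comm (singularProductPartial Ψ n), ← mul_assoc,
    inv_mul_cancel₀ (pow_pos hPi0 t).ne', one_mul]

/-- **Mertens**: `P/φ(P) ≤ e⁵ log n` for `P = P(n + 1) = ∏_{p ≤ n} p`, `n ≥ 2` (tree: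
`MertensBound.exp_neg_div_log_le_prod_one_sub_inv`, `∏_{p ≤ n} (1 − 1/p) ≥ e^{−5}/log n`). [folklore] -/
theorem weight_le {n : ℕ} (hn : 2 ≤ n) :
    (primesProdBelow ((n + 1 : ℕ) : ℝ) : ℝ) / (Nat.totient (primesProdBelow ((n + 1 : ℕ) : ℝ)) : ℝ) ≤
      Real.exp 5 * Real.log n := by
  have hPi : ((Nat.totient (primesProdBelow ((n + 1 : ℕ) : ℝ)) : ℕ) : ℝ) /
      (primesProdBelow ((n + 1 : ℕ) : ℝ) : ℝ) = ∏ p ∈ Nat.primesBelow (n + 1), (1 - (p : ℝ)⁻¹) := by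
    have h := totient_primesProdBelow_div ((n + 1 : ℕ) : ℝ)
    rwa [Nat.ceil_natCast] at h
  have hmert : Real.exp (-5) / Real.log n ≤ ∏ p ∈ Nat.primesBelow (n + 1), (1 - (p : ℝ)⁻¹) := by
    refine (Literature.NumberTheory.LFunctions.MertensBound.exp_neg_div_log_le_prod_one_sub_inv
      n hn).trans (le_of_eq ?_)
    exact Finset.prod_congr rfl fun p _ => by rw [one_div]
  have hn2 : (2 : ℝ) ≤ n := by exact_mod_cast hn
  have hlog : 0 < Real.log n := Real.log_pos (by linarith)
  have hpos : 0 < Real.exp (-5) / Real.log n := by positivity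
  have hinv := inv_anti₀ hpos hmert
  rw [← hPi, inv_div, inv_div, Real.exp_neg, div_inv_eq_mul, mul_comm] at hinv
  exact hinv

/-! ### Thresholds in `N` -/

/-- `log N ≤ u_N²` (`u_N = ⌈√(log N)⌉`). [folklore] -/
theorem log_le_roughExp_sq (N : ℕ) : Real.log N ≤ (roughExp N : ℝ) ^ 2 := by
  rcases le_or_gt 0 (Real.log N) with h | h
  · calc Real.log N = Real.sqrt (Real.log N) ^ 2 := (Real.sq_sqrt h).symm
      _ ≤ (roughExp N : ℝ) ^ 2 :=
          pow_le_pow_left₀ (Real.sqrt_nonneg _) (Nat.le_ceil _) 2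
  · exact h.le.trans (sq_nonneg _)

/-- **The sieve level.** For `c ≥ 1`, eventually `N ≥ 1`, `u_N ≥ 17`, `y_N ≥ c` and
`⌊y_N⌋ + 1 ≤ N^{1/8}` (`log y_N = log N/⌈√(log N)⌉ ≥ √(log N) − 1 → ∞` and `y_N ≤ N^{1/17}` once
`u_N ≥ 17`, with `N^{1/17} + 1 ≤ N^{1/8}`, tree `AbsoluteUpgrade.eventually_level`); registered sub-goal of
stmt-Parity-0819 (helper for `stub_sieveCount`). [folklore] -/
theorem eventually_roughLevel : ∀ (c : ℝ), 1 ≤ c → ∀ᶠ N : ℕ in Filter.atTop, (1 : ℝ) ≤ N ∧ 17 ≤ roughExp N ∧ c ≤ roughLevel N ∧ ((⌊roughLevel N⌋₊ + 1 : ℕ) : ℝ) ≤ (N : ℝ) ^ ((1 : ℝ) / 8) := by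
  intro c hc
  filter_upwards [eventually_log_ge (max 289 ((Real.log c + 1) ^ 2)), eventually_ge_real 1,
    eventually_level] with N hlog hN1 hlev
  have h289 : (289 : ℝ) ≤ Real.log N := le_trans (le_max_left _ _) hlog
  have hlc : (Real.log c + 1) ^ 2 ≤ Real.log N := le_trans (le_max_right _ _) hlog
  have hN0 : (0 : ℝ) < N := by linarith
  set s := Real.sqrt (Real.log N) with hs
  have hs0 : 0 ≤ s := Real.sqrt_nonneg _
  have hss : s ^ 2 = Real.log N := Real.sq_sqrt (by linarith)
  have hs17 : (17 : ℝ) ≤ s := Real.le_sqrt_of_sq_le (by norm_num; exact h289)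
  have hlogc0 : 0 ≤ Real.log c := Real.log_nonneg hc
  have hsc : Real.log c + 1 ≤ s := Real.le_sqrt_of_sq_le hlc
  have hu_ge : s ≤ (roughExp N : ℝ) := Nat.le_ceil _
  have hu_lt : (roughExp N : ℝ) < s + 1 := Nat.ceil_lt_add_one hs0
  have hu17 : 17 ≤ roughExp N := by
    have h : (17 : ℝ) ≤ (roughExp N : ℝ) := hs17.trans hu_ge
    exact_mod_cast h
  have hu0 : (0 : ℝ) < roughExp N := by exact_mod_cast (show 0 < roughExp N by omega)
  refine ⟨hN1, hu17, ?_, ?_⟩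
  · -- `c = e^{log c} ≤ e^{log N/u} = y`
    have hc0 : 0 < c := by linarith
    have hylog : roughLevel N = Real.exp (Real.log N / roughExp N) := by
      rw [roughLevel, Real.rpow_def_of_pos hN0, mul_one_div]
    rw [hylog]
    calc c = Real.exp (Real.log c) := (Real.exp_log hc0).symm
      _ ≤ Real.exp (Real.log N / roughExp N) := by
          rw [Real.exp_le_exp, le_div_iff₀ hu0]
          calc Real.log c * roughExp N ≤ Real.log c * (s + 1) :=
                mul_le_mul_of_nonneg_left hu_lt.le hlogc0
            _ ≤ s ^ 2 := by
                nlinarith [mul_nonneg hs0 (by linarith : (0 : ℝ) ≤ s - Real.log c - 1)]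
            _ = Real.log N := hss
  · -- `⌊y⌋ + 1 ≤ y + 1 ≤ N^{1/17} + 1 ≤ N^{1/8}`
    have hy17 : roughLevel N ≤ (N : ℝ) ^ ((1 : ℝ) / 17) := by
      rw [roughLevel]
      refine Real.rpow_le_rpow_of_exponent_le hN1 ?_
      have h17 : (17 : ℝ) ≤ roughExp N := by exact_mod_cast hu17
      rw [div_le_div_iff₀ hu0 (by norm_num)]
      linarith
    have hy0 : 0 ≤ roughLevel N := by rw [roughLevel]; positivity
    push_cast
    linarith [Nat.floor_le hy0]

/-- **Decay of the main error term**: for `A ≥ 0` and `η > 0`, eventually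
`A (log N)^t e^{−u_N/16} ≤ η` (`(log N)^t ≤ u_N^{2t}` and `x^{2t} e^{−x/16} → 0`, `u_N ≥ √(log N) → ∞`).
[folklore] -/
theorem eventually_decay (t : ℕ) {A η : ℝ} (hA : 0 ≤ A) (hη : 0 < η) :
    ∀ᶠ N : ℕ in atTop,
      A * Real.log N ^ t * Real.exp (-((1 : ℝ) / 16 * roughExp N)) ≤ η := by
  -- `g(x) = (A + 1) x^{2t} e^{−x/16} → 0`
  have h1 := (Real.tendsto_pow_mul_exp_neg_atTop_nhds_zero (2 * t)).comp
    (tendsto_id.const_mul_atTop (by norm_num : (0 : ℝ) < 1 / 16))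
  have h2 : Tendsto (fun x : ℝ => (A + 1) * 16 ^ (2 * t) *
      (((1 : ℝ) / 16 * x) ^ (2 * t) * Real.exp (-((1 : ℝ) / 16 * x)))) atTop (nhds 0) := by
    have h := h1.const_mul ((A + 1) * 16 ^ (2 * t))
    rw [mul_zero] at h
    exact h
  have h16 : (16 : ℝ) ^ (2 * t) * ((1 : ℝ) / 16) ^ (2 * t) = 1 := by
    rw [← mul_pow]; norm_num
  have hg : Tendsto (fun x : ℝ => (A + 1) * (x ^ (2 * t) * Real.exp (-((1 : ℝ) / 16 * x))))
      atTop (nhds 0) := by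
    refine h2.congr fun x => ?_
    rw [mul_pow]
    calc (A + 1) * 16 ^ (2 * t) * (((1 : ℝ) / 16) ^ (2 * t) * x ^ (2 * t) *
          Real.exp (-((1 : ℝ) / 16 * x)))
        = (A + 1) * (16 ^ (2 * t) * ((1 : ℝ) / 16) ^ (2 * t)) *
            (x ^ (2 * t) * Real.exp (-((1 : ℝ) / 16 * x))) := by ring
      _ = _ := by rw [h16, mul_one]
  obtain ⟨x₀, hx₀⟩ := Filter.eventually_atTop.mp (hg.eventually_le_const hη)
  filter_upwards [eventually_log_ge (max x₀ 0 ^ 2), eventually_ge_real 1] with N hlog hN1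
  have hl0 : 0 ≤ Real.log N := Real.log_nonneg hN1
  have hux : x₀ ≤ (roughExp N : ℝ) :=
    (le_max_left _ _).trans ((Real.le_sqrt_of_sq_le hlog).trans (Nat.le_ceil _))
  have hb := hx₀ (roughExp N) hux
  have hlu : Real.log N ^ t ≤ (roughExp N : ℝ) ^ (2 * t) := by
    rw [pow_mul]
    exact pow_le_pow_left₀ hl0 (log_le_roughExp_sq N) t
  have hE0 : 0 ≤ Real.exp (-((1 : ℝ) / 16 * roughExp N)) := (Real.exp_pos _).le
  calc A * Real.log N ^ t * Real.exp (-((1 : ℝ) / 16 * roughExp N))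
      = A * (Real.log N ^ t * Real.exp (-((1 : ℝ) / 16 * roughExp N))) := mul_assoc _ _ _
    _ ≤ (A + 1) * ((roughExp N : ℝ) ^ (2 * t) * Real.exp (-((1 : ℝ) / 16 * roughExp N))) :=
        mul_le_mul (by linarith) (mul_le_mul_of_nonneg_right hlu hE0) (by positivity) (by linarith)
    _ ≤ η := hb

/-- **The remainder is negligible**: for `A ≥ 0` and `η > 0`, eventually
`A (log N)^t N^{1/4} ≤ η N` (`(log N)^t = o(N^{3/4})`, Mathlib `isLittleO_log_rpow_rpow_atTop`).
[folklore] -/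
theorem eventually_pow_log_mul_rpow (t : ℕ) {A η : ℝ} (hA : 0 ≤ A) (hη : 0 < η) :
    ∀ᶠ N : ℕ in atTop, A * Real.log N ^ t * (N : ℝ) ^ ((1 : ℝ) / 4) ≤ η * N := by
  have h := ((isLittleO_log_rpow_rpow_atTop (t : ℝ) (by norm_num : (0 : ℝ) < 3 / 4)).bound
    (show (0 : ℝ) < η / (A + 1) by positivity))
  filter_upwards [tendsto_natCast_atTop_atTop.eventually h, eventually_ge_real 1] with N hN hN1
  have hl0 : 0 ≤ Real.log N := Real.log_nonneg hN1
  have hN0 : (0 : ℝ) ≤ N := Nat.cast_nonneg N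
  rw [Real.norm_of_nonneg (Real.rpow_nonneg hl0 _), Real.norm_of_nonneg (Real.rpow_nonneg hN0 _),
    Real.rpow_natCast] at hN
  have hsplit : (N : ℝ) ^ ((3 : ℝ) / 4) * (N : ℝ) ^ ((1 : ℝ) / 4) = N := by
    rw [← Real.rpow_add' hN0 (by norm_num)]
    norm_num
  have hq0 : 0 ≤ (N : ℝ) ^ ((1 : ℝ) / 4) := Real.rpow_nonneg hN0 _
  have hA1 : A / (A + 1) ≤ 1 := (div_le_one (by linarith)).mpr (by linarith)
  calc A * Real.log N ^ t * (N : ℝ) ^ ((1 : ℝ) / 4)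
      ≤ A * (η / (A + 1) * (N : ℝ) ^ ((3 : ℝ) / 4)) * (N : ℝ) ^ ((1 : ℝ) / 4) :=
        mul_le_mul_of_nonneg_right (mul_le_mul_of_nonneg_left hN hA) hq0
    _ = A / (A + 1) * η * ((N : ℝ) ^ ((3 : ℝ) / 4) * (N : ℝ) ^ ((1 : ℝ) / 4)) := by ring
    _ = A / (A + 1) * η * N := by rw [hsplit]
    _ ≤ 1 * η * N := by gcongr
    _ = η * N := by rw [one_mul]

end Summit.Parity.GeneralizedHardyLittlewood.Cruxes.DimOne.BirthSieve

end
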